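import Literature.Probability.Percolation.KozmaNitzanSeparatingTriple
import Literature.Probability.Percolation.KozmaNitzanGoodQuadruple
import Summits.CriticalPhenomena.PercolationContinuityZ3.Theorems.PercNearOneGluingNoHeavyLowerTailKNQuestion7AllRelays
import HarnessLib

/-!
# `NoHeavyLowerTail` (stmt-CriticalPhenomena-4575) — EVERY quadruple with two relays is good
# (Kozma–Nitzan goodness for an arbitrary observer when `|A| = 2`)

Support file (`--supports stmt-CriticalPhenomena-4575`, hull-port prover `prim-hp-2`, gen 10).  No definitions, no named
facts, no sorries.

Kozma–Nitzan (arXiv:2401.12397, §3.2 p. 12) call a quadruple `(G, A, 0, b)` — `0` and `b` in different components of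
`G ∖ A` — GOOD if `P(0 ↔ b) ≥ min_a P(a ↔ b) − Σ_{W ∩ A = ∅} P(C(0) = W) · min_a P_{G∖W}(a ↔ b)`, and prove goodness for
one-layer observers (Theorem 4) and for chains (Theorem 5).  The tree's `KNGood*` files (prim-hp-2 gens 3–8) prove it for
several depth-two observers over arbitrary cores.  Here the observer `0` is ARBITRARY (any depth, any pocket) and the relay
set has two points:

* `KNGoodTwoRelays.two_sep_openConn_eq` — two-point amalgamation: if removing `A = {a₁, a₂}` separates the interior `VB`
  of the observer's side from the rest, then for `x ∈ {a₁, a₂}`: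
  `P(x ↔ b) = P_B(a₁ ↔ a₂) · P_{T/a₁a₂}(x ↔ b) + (1 − P_B(a₁ ↔ a₂)) · P_T(x ↔ b)`,
  with `B` = the pairs inside `VB ∪ A`, `T` = the other side (`KNSep.rB`, `KNSep.rT` of the Literature file
  `KozmaNitzanSeparatingTriple`).  Hence `P(a₂ ↔ b) − P(a₁ ↔ b) = (1 − P_B(a₁ ↔ a₂)) · (P_T(a₂ ↔ b) − P_T(a₁ ↔ b))`:
  the ORDER of the two relays is that of the `T`-side (`two_sep_le`), and it is the same in every graph `G ∖ W`, `W ⊆ VB`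
  (`openConnIn_le_of_T_le`).
* `KNGoodTwoRelays.knGood_two_relays` — **every quadruple `(G, {a₁, a₂}, 0, b)` with `0 ∈ VB`, `b, a₁, a₂ ∉ VB` and no
  positive weight across is good.**  Proof: by the sign constancy the pocket-wise minimiser in the correction term is the
  global minimiser `c`, so the correction term equals `P(c ↔ b, 0 ↮ A)`, and goodness becomes Kozma–Nitzan's Question 7 at
  the designated minimiser, `P(c ↔ b, 0 ↔ A) ≤ P(0 ↔ b)` — in the tree for every relay set (`Q7Psi.kn_question7_fintype`).
  Pockets `W ⊄ VB` have `P(C(0) = W) = 0` (`real_clusterIs_eq_zero_of_not_subset`).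

[cite: KozmaNitzan2024, §3.2 Definition and Thms. 4–5 (pp. 12–14), Thm. 1 (p. 7), Question 7 (p. 36)]
-/

noncomputable section

namespace Summit.CriticalPhenomena.PercolationContinuityZ3.Theorems

open MeasureTheory Set Literature.Probability.LatticeModels Literature.Probability.Percolation
open scoped Classical

namespace KNGoodTwoRelays

open KNSep KNGoodAux

variable {V : Type*} [Fintype V]

/-! ### The two sides of a two-point separator -/

omit [Fintype V] in
/-- On the sure set of a separated weight function there are no open cross pairs. [folklore] -/
theorem noCross_of_mem_sureSet (u : Sym2 V → unitInterval) (VB A : Set V)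
    (hcut : ∀ e, e ∉ sideB VB A → e ∉ sideT VB A → u e = 0)
    {ω : BondConfig V} (hω : ω ∈ sureSet u) : noCross VB A ω := by
  intro e he
  by_contra h
  rw [not_or] at h
  exact (hω e).1 (hcut e h.1 h.2) he

omit [Fintype V] in
/-- The `T`-side pairs lie off the `B`-side. [folklore] -/
theorem sideT_subset_compl_sideB (VB A : Set V) : sideT VB A ⊆ (sideB VB A)ᶜ := by
  intro e he hB
  exact he.2 fun v hv => (hB v hv).resolve_left (he.1 v hv)

omit [Fintype V] in
/-- Glued `T`-connectivity is monotone in the glue set. [folklore] -/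
theorem rT_mono {VB A : Set V} {F F' : Set (Sym2 V)} (hFF : F ⊆ F') {ω : BondConfig V} {x y : V}
    (h : rT VB A F ω x y) : rT VB A F' ω x y :=
  SimpleGraph.Reachable.mono (SimpleGraph.fromEdgeSet_mono (union_subset_union_right _ hFF)) h

omit [Fintype V] in
/-- For `A = {a₁, a₂}` the glue set is contained in `{s(a₁, a₂)}`. [folklore] -/
theorem glueSet_subset_pair (VB : Set V) (a₁ a₂ : V) (ω : BondConfig V) :
    glueSet VB ({a₁, a₂} : Set V) ω ⊆ {s(a₁, a₂)} := by
  intro e he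
  induction e using Sym2.ind with
  | h x y =>
    obtain ⟨hx, hy, hne, -⟩ := (mk_mem_glueSet_iff ω x y).1 he
    rw [mem_singleton_iff]
    rcases hx with rfl | rfl <;> rcases hy with rfl | rfl
    · exact absurd rfl hne
    · rfl
    · exact Sym2.eq_swap
    · exact absurd rfl hne

omit [Fintype V] in
/-- For `A = {a₁, a₂}`, `a₁ ≠ a₂`: `s(a₁,a₂)` is glued iff `a₁ ↔_B a₂`. [folklore] -/
theorem mk_mem_glueSet_pair_iff (VB : Set V) {a₁ a₂ : V} (h12 : a₁ ≠ a₂) (ω : BondConfig V) :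
    s(a₁, a₂) ∈ glueSet VB ({a₁, a₂} : Set V) ω ↔ rB VB ({a₁, a₂} : Set V) ω a₁ a₂ := by
  rw [mk_mem_glueSet_iff]
  exact ⟨fun h => h.2.2.2, fun h => ⟨by simp, by simp, h12, h⟩⟩

omit [Fintype V] in
/-- **Two-point amalgamation, configurationwise.**  No cross pairs, `x, b` off the `B`-interior: `x ↔ b` iff
(`a₁ ↔_B a₂` and `x ↔ b` in `T/a₁a₂`) or (`a₁ ↮_B a₂` and `x ↔ b` in `T`).
[cite: KozmaNitzan2024, proof of Thm. 3 (pp. 10–11) — the case |A| = 2] -/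
theorem reachable_iff_pair {VB : Set V} {a₁ a₂ : V} (h12 : a₁ ≠ a₂) {ω : BondConfig V}
    (hω : noCross VB ({a₁, a₂} : Set V) ω) {x b : V} (hx : x ∉ VB) (hb : b ∉ VB) :
    (openGraph ω).Reachable x b ↔
      (rB VB ({a₁, a₂} : Set V) ω a₁ a₂ ∧ rT VB ({a₁, a₂} : Set V) {s(a₁, a₂)} ω x b) ∨
      (¬ rB VB ({a₁, a₂} : Set V) ω a₁ a₂ ∧ rT VB ({a₁, a₂} : Set V) ∅ ω x b) := by
  rw [reachable_iff_rT hω hx hb]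
  have hsub := glueSet_subset_pair VB a₁ a₂ ω
  by_cases hr : rB VB ({a₁, a₂} : Set V) ω a₁ a₂
  · have heq : glueSet VB ({a₁, a₂} : Set V) ω = {s(a₁, a₂)} :=
      Subset.antisymm hsub (singleton_subset_iff.2 ((mk_mem_glueSet_pair_iff VB h12 ω).2 hr))
    rw [heq]
    simp [hr]
  · have heq : glueSet VB ({a₁, a₂} : Set V) ω = ∅ := by
      refine eq_empty_of_subset_empty fun e he => ?_
      have := hsub he
      rw [mem_singleton_iff] at this
      subst this
      exact hr ((mk_mem_glueSet_pair_iff VB h12 ω).1 he)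
    rw [heq]
    simp [hr]

/-- **Two-point amalgamation, in probability.**  `A = {a₁, a₂}` separates `VB` from the rest (no positive weight on a
cross pair), `x, b ∉ VB`.  Then
`P(x ↔ b) = P(a₁ ↔_B a₂)·P(x ↔ b in T/a₁a₂) + (1 − P(a₁ ↔_B a₂))·P(x ↔ b in T)`
(the `B`-side and the `T`-side read disjoint sets of pairs, product measure).
[cite: KozmaNitzan2024, proof of Thm. 3 (pp. 10–11), eq. (11) — the case |A| = 2] -/
theorem two_sep_openConn_eq (u : Sym2 V → unitInterval) (VB : Set V) {a₁ a₂ : V} (h12 : a₁ ≠ a₂)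
    (hcut : ∀ e, e ∉ sideB VB ({a₁, a₂} : Set V) → e ∉ sideT VB ({a₁, a₂} : Set V) → u e = 0)
    {x b : V} (hx : x ∉ VB) (hb : b ∉ VB) :
    (prodBernoulli u).real (openConn x b) =
      (prodBernoulli u).real {ω : BondConfig V | rB VB ({a₁, a₂} : Set V) ω a₁ a₂} *
          (prodBernoulli u).real {ω : BondConfig V | rT VB ({a₁, a₂} : Set V) {s(a₁, a₂)} ω x b} +
        (1 - (prodBernoulli u).real {ω : BondConfig V | rB VB ({a₁, a₂} : Set V) ω a₁ a₂}) *
          (prodBernoulli u).real {ω : BondConfig V | rT VB ({a₁, a₂} : Set V) ∅ ω x b} := by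
  set A : Set V := {a₁, a₂} with hA
  set μ := prodBernoulli u with hμ
  haveI : IsProbabilityMeasure μ := by rw [hμ]; infer_instance
  have hmeas : ∀ S : Set (BondConfig V), MeasurableSet S := fun _ => MeasurableSet.of_discrete
  set RB : Set (BondConfig V) := {ω | rB VB A ω a₁ a₂} with hRB
  set R1 : Set (BondConfig V) := {ω | rT VB A {s(a₁, a₂)} ω x b} with hR1
  set R0 : Set (BondConfig V) := {ω | rT VB A ∅ ω x b} with hR0
  -- configurationwise decomposition on the sure set
  have hsure : (openConn x b : Set (BondConfig V)) ∩ sureSet u = ((RB ∩ R1) ∪ (RBᶜ ∩ R0)) ∩ sureSet u := by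
    ext ω
    simp only [mem_inter_iff, mem_union, mem_compl_iff, hRB, hR1, hR0, mem_setOf_eq]
    constructor
    · rintro ⟨hxb, hω⟩
      exact ⟨(reachable_iff_pair h12 (noCross_of_mem_sureSet u VB A hcut hω) hx hb).1 hxb, hω⟩
    · rintro ⟨h, hω⟩
      exact ⟨(reachable_iff_pair h12 (noCross_of_mem_sureSet u VB A hcut hω) hx hb).2 h, hω⟩
  rw [real_eq_of_inter_sureSet u hsure]
  have hdisj : Disjoint (RB ∩ R1) (RBᶜ ∩ R0) :=
    Set.disjoint_left.2 fun ω h h' => h'.1 h.1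
  rw [measureReal_union hdisj (hmeas _)]
  -- independence of the two sides
  have hTB := sideT_subset_compl_sideB VB A
  have hdetB : DeterminedBy RB (sideB VB A) := by
    rw [determinedBy_iff]
    intro ω ω' h
    simp only [hRB, mem_setOf_eq, KNSep.rB, h]
  have hdetBc : DeterminedBy RBᶜ (sideB VB A) := by
    rw [determinedBy_iff]
    intro ω ω' h
    simp only [mem_compl_iff, hRB, mem_setOf_eq, KNSep.rB, h]
  have hdetT : ∀ F : Set (Sym2 V), DeterminedBy {ω : BondConfig V | rT VB A F ω x b} (sideB VB A)ᶜ := by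
    intro F
    rw [determinedBy_iff]
    intro ω ω' h
    have e1 : ∀ ω : BondConfig V, ω ∩ sideT VB A = (ω ∩ (sideB VB A)ᶜ) ∩ sideT VB A := fun ω => by
      rw [inter_assoc, inter_eq_right.2 hTB]
    simp only [mem_setOf_eq, KNSep.rT]
    rw [e1 ω, e1 ω', h]
  have i1 : μ.real (RB ∩ R1) = μ.real RB * μ.real R1 :=
    real_inter_of_determinedBy_compl u (sideB VB A) hdetB (hdetT _)
  have i0 : μ.real (RBᶜ ∩ R0) = μ.real RBᶜ * μ.real R0 :=
    real_inter_of_determinedBy_compl u (sideB VB A) hdetBc (hdetT _)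
  rw [i1, i0, probReal_compl_eq_one_sub (hmeas RB)]

omit [Fintype V] in
/-- In `T/a₁a₂` the two relays are interchangeable: `{a₁ ↔ b in T/a₁a₂} = {a₂ ↔ b in T/a₁a₂}`. [folklore] -/
theorem rT_pair_eq (VB A : Set V) {a₁ a₂ : V} (h12 : a₁ ≠ a₂) (b : V) :
    {ω : BondConfig V | rT VB A {s(a₁, a₂)} ω a₁ b} = {ω : BondConfig V | rT VB A {s(a₁, a₂)} ω a₂ b} := by
  ext ω
  have adj : (openGraph (ω ∩ sideT VB A ∪ {s(a₁, a₂)})).Adj a₁ a₂ :=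
    (openGraph_adj _ a₁ a₂).2 ⟨Or.inr (mem_singleton _), h12⟩
  simp only [mem_setOf_eq, KNSep.rT]
  exact ⟨fun h => adj.symm.reachable.trans h, fun h => adj.reachable.trans h⟩

/-- **Sign constancy.**  In the setting of `two_sep_openConn_eq`:
`P(a₂ ↔ b) − P(a₁ ↔ b) = (1 − P(a₁ ↔_B a₂)) · (P(a₂ ↔ b in T) − P(a₁ ↔ b in T))`; in particular
`P(a₁ ↔ b in T) ≤ P(a₂ ↔ b in T)` implies `P(a₁ ↔ b) ≤ P(a₂ ↔ b)`.
[cite: KozmaNitzan2024, proof of Thm. 3, eq. (11) (p. 11) — the case |A| = 2] -/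
theorem two_sep_le (u : Sym2 V → unitInterval) (VB : Set V) {a₁ a₂ : V} (h12 : a₁ ≠ a₂)
    (hcut : ∀ e, e ∉ sideB VB ({a₁, a₂} : Set V) → e ∉ sideT VB ({a₁, a₂} : Set V) → u e = 0)
    {b : V} (ha₁ : a₁ ∉ VB) (ha₂ : a₂ ∉ VB) (hb : b ∉ VB)
    (hs : (prodBernoulli u).real {ω : BondConfig V | rT VB ({a₁, a₂} : Set V) ∅ ω a₁ b} ≤
      (prodBernoulli u).real {ω : BondConfig V | rT VB ({a₁, a₂} : Set V) ∅ ω a₂ b}) :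
    (prodBernoulli u).real (openConn a₁ b) ≤ (prodBernoulli u).real (openConn a₂ b) := by
  haveI : IsProbabilityMeasure (prodBernoulli u) := inferInstance
  rw [two_sep_openConn_eq u VB h12 hcut ha₁ hb, two_sep_openConn_eq u VB h12 hcut ha₂ hb,
    rT_pair_eq VB ({a₁, a₂} : Set V) h12 b]
  have hc1 : (prodBernoulli u).real {ω : BondConfig V | rB VB ({a₁, a₂} : Set V) ω a₁ a₂} ≤ 1 :=
    measureReal_le_one
  have := mul_le_mul_of_nonneg_left hs (sub_nonneg.2 hc1)
  linarith

/-! ### The order of the two relays in the graphs `G ∖ W`, `W ⊆ VB` -/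

/-- **The relay order is the same in every `G ∖ W`, `W ⊆ VB`.**  If `P(a₁ ↔ b in T) ≤ P(a₂ ↔ b in T)` then for every
`W ⊆ VB`: `P(a₁ ↔ b off W) ≤ P(a₂ ↔ b off W)` (deleting `W` = weights restricted to `Wᶜ`, which keeps the separation and
does not touch the `T`-side). [cite: KozmaNitzan2024, §3.2 p. 12 (the graphs G ∖ W), proof of Thm. 3 (pp. 10–11)] -/
theorem openConnIn_le_of_T_le (w : Sym2 V → unitInterval) (VB : Set V) {a₁ a₂ : V} (h12 : a₁ ≠ a₂)
    (hcut : ∀ e, e ∉ sideB VB ({a₁, a₂} : Set V) → e ∉ sideT VB ({a₁, a₂} : Set V) → w e = 0)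
    {b : V} (ha₁ : a₁ ∉ VB) (ha₂ : a₂ ∉ VB) (hb : b ∉ VB)
    (hs : (prodBernoulli w).real {ω : BondConfig V | rT VB ({a₁, a₂} : Set V) ∅ ω a₁ b} ≤
      (prodBernoulli w).real {ω : BondConfig V | rT VB ({a₁, a₂} : Set V) ∅ ω a₂ b})
    (W : Finset V) (hW : (↑W : Set V) ⊆ VB) :
    (prodBernoulli w).real (openConnIn ((↑W : Set V)ᶜ) a₁ b) ≤
      (prodBernoulli w).real (openConnIn ((↑W : Set V)ᶜ) a₂ b) := by
  set A : Set V := {a₁, a₂} with hA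
  set uW : Sym2 V → unitInterval := restrW ((↑W : Set V)ᶜ) w with huW
  -- the restricted weights are still separated
  have hcutW : ∀ e, e ∉ sideB VB A → e ∉ sideT VB A → uW e = 0 := by
    intro e h1 h2
    by_cases he : e ∈ wireSet ((↑W : Set V)ᶜ)
    · rw [huW, restrW_apply_of_mem w he]; exact hcut e h1 h2
    · rw [huW, restrW_apply_of_not_mem w he]
  -- connection for the restricted weights = connection off `W`
  have hconn : ∀ {x : V}, x ∉ VB →
      (prodBernoulli uW).real (openConn x b) = (prodBernoulli w).real (openConnIn ((↑W : Set V)ᶜ) x b) := by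
    intro x hx
    have hxW : x ∈ ((↑W : Set V)ᶜ) := fun h => hx (hW h)
    rw [huW, KNGoodAux.restrW_real_eq]
    congr 1
    ext ω
    exact KNGoodAux.inter_wireSet_mem_openConn_iff hxW b
  -- the `T`-side events do not see the restriction
  have hT : ∀ x : V, (prodBernoulli uW).real {ω : BondConfig V | rT VB A ∅ ω x b} =
      (prodBernoulli w).real {ω : BondConfig V | rT VB A ∅ ω x b} := by
    intro x
    set E : Set (Sym2 V) := {e | e ∈ sideT VB A ∧ ¬ e.IsDiag} with hE
    refine real_eq_of_agree uW w E (fun e he => ?_) ?_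
    · have heW : e ∈ wireSet ((↑W : Set V)ᶜ) := by
        refine ⟨fun v hv hvW => he.1.1 v hv (hW hvW), he.2⟩
      rw [huW, restrW_apply_of_mem w heW]
    · rw [determinedBy_iff]
      intro ω ω' h
      have key : ∀ p q : V, (openGraph (ω ∩ sideT VB A ∪ ∅)).Adj p q ↔ (openGraph (ω' ∩ sideT VB A ∪ ∅)).Adj p q := by
        intro p q
        simp only [union_empty, openGraph_adj, mem_inter_iff]
        constructor
        · rintro ⟨⟨hm, hTm⟩, hne⟩
          have h1 : s(p, q) ∈ ω ∩ E := ⟨hm, hTm, by rwa [Sym2.mk_isDiag_iff]⟩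
          rw [h] at h1
          exact ⟨⟨h1.1, hTm⟩, hne⟩
        · rintro ⟨⟨hm, hTm⟩, hne⟩
          have h1 : s(p, q) ∈ ω' ∩ E := ⟨hm, hTm, by rwa [Sym2.mk_isDiag_iff]⟩
          rw [← h] at h1
          exact ⟨⟨h1.1, hTm⟩, hne⟩
      have hG : openGraph (ω ∩ sideT VB A ∪ ∅) = openGraph (ω' ∩ sideT VB A ∪ ∅) := by
        ext p q; exact key p q
      simp only [mem_setOf_eq, KNSep.rT, hG]
  have hle := two_sep_le uW VB h12 hcutW ha₁ ha₂ hb (by rw [hT a₁, hT a₂]; exact hs)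
  rwa [hconn ha₁, hconn ha₂] at hle

/-! ### Goodness -/

/-- A pocket of the observer that leaves `VB` has probability `0` (it would use a cross pair).
[cite: KozmaNitzan2024, §3.2 p. 12 (the sum over W ∩ A = ∅)] -/
theorem real_clusterIs_eq_zero_of_not_subset (w : Sym2 V → unitInterval) (VB : Set V) (A : Finset V) (o : V)
    (hcut : ∀ e, e ∉ sideB VB (↑A : Set V) → e ∉ sideT VB (↑A : Set V) → w e = 0) (ho : o ∈ VB)
    (W : Finset V) (hWA : Disjoint W A) (hWVB : ¬ (↑W : Set V) ⊆ VB) :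
    (prodBernoulli w).real (clusterIs o W) = 0 := by
  have h0 : (prodBernoulli w).real (∅ : Set (BondConfig V)) = 0 := by simp
  rw [← h0]
  refine real_eq_of_inter_sureSet w ?_
  rw [empty_inter]
  refine eq_empty_of_subset_empty ?_
  rintro ω ⟨hC, hω⟩
  obtain ⟨v, hvW, hvVB⟩ := not_subset.1 hWVB
  rw [mem_clusterIs] at hC
  have hreach : (openGraph ω).Reachable o v := by
    have : v ∈ openCluster ω o := by rw [hC]; exact hvW
    exact this
  have hnc := noCross_of_mem_sureSet w VB (↑A : Set V) hcut hω
  obtain ⟨a, haA, hoa, -⟩ := (amalgam hnc hreach).2.2.1 ho hvVB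
  have haW : a ∈ (↑W : Set V) := by rw [← hC]; exact hoa.reachable
  exact Finset.disjoint_left.1 hWA (Finset.mem_coe.1 haW) (Finset.mem_coe.1 haA)

/-- **Every quadruple with two relays is good — designated form.**  `0 ∈ VB`, `a₁, a₂, b ∉ VB`, no positive weight on a
pair across (`A = {a₁, a₂}` separates `0` from `b`), and `a₁` no more `b`-reliable than `a₂` on the `T`-side.  Then
`(G, {a₁, a₂}, 0, b)` is good. [cite: KozmaNitzan2024, §3.2 Definition (p. 12), Question 7 (p. 36)] -/
theorem knGood_two_relays_of_le [DecidableEq V] (w : Sym2 V → unitInterval) (VB : Set V) (A : Finset V) (hA : A.Nonempty)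
    (o b a₁ a₂ : V) (hAeq : (↑A : Set V) = {a₁, a₂}) (h12 : a₁ ≠ a₂) (ho : o ∈ VB)
    (ha₁ : a₁ ∉ VB) (ha₂ : a₂ ∉ VB) (hb : b ∉ VB)
    (hcut : ∀ e, e ∉ sideB VB ({a₁, a₂} : Set V) → e ∉ sideT VB ({a₁, a₂} : Set V) → w e = 0)
    (hs : (prodBernoulli w).real {ω : BondConfig V | rT VB ({a₁, a₂} : Set V) ∅ ω a₁ b} ≤
      (prodBernoulli w).real {ω : BondConfig V | rT VB ({a₁, a₂} : Set V) ∅ ω a₂ b}) :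
    KNGood w A hA o b := by
  set μ := prodBernoulli w with hμ
  haveI : IsProbabilityMeasure μ := by rw [hμ]; infer_instance
  have hmeas : ∀ S : Set (BondConfig V), MeasurableSet S := fun _ => MeasurableSet.of_discrete
  have hmemA : ∀ a : V, a ∈ A ↔ a = a₁ ∨ a = a₂ := by
    intro a
    rw [← Finset.mem_coe, hAeq]
    simp
  have ha1A : a₁ ∈ A := (hmemA a₁).2 (Or.inl rfl)
  -- the designated relay `a₁` is minimal in `G` and in every `G ∖ W`, `W ⊆ VB`
  have hcmin : ∀ a ∈ A, μ.real (openConn a₁ b) ≤ μ.real (openConn a b) := by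
    intro a ha
    rcases (hmemA a).1 ha with rfl | rfl
    · exact le_rfl
    · exact two_sep_le w VB h12 hcut ha₁ ha₂ hb hs
  have hcminW : ∀ W : Finset V, (↑W : Set V) ⊆ VB → ∀ a ∈ A,
      μ.real (openConnIn ((↑W : Set V)ᶜ) a₁ b) ≤ μ.real (openConnIn ((↑W : Set V)ᶜ) a b) := by
    intro W hW a ha
    rcases (hmemA a).1 ha with rfl | rfl
    · exact le_rfl
    · exact openConnIn_le_of_T_le w VB h12 hcut ha₁ ha₂ hb hs W hW
  -- Question 7 at the designated minimiser
  set U : Set (BondConfig V) := ⋃ a' ∈ A, openConn o a' with hU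
  have hq7 : μ.real (openConn a₁ b ∩ U) ≤ μ.real (openConn o b ∩ U) :=
    Q7Psi.kn_question7_fintype w A o b a₁ ha1A hcmin
  have hq7' : μ.real (openConn o b ∩ U) ≤ μ.real (openConn o b) :=
    measureReal_mono inter_subset_left
  -- the correction term equals `P(a₁ ↔ b, 0 ↮ A)`
  have hsplit : μ.real (openConn a₁ b ∩ U) + μ.real (openConn a₁ b \ U) = μ.real (openConn a₁ b) :=
    measureReal_inter_add_sdiff (hmeas U)
  have hdiff : (openConn a₁ b : Set (BondConfig V)) \ U =
      {ω : BondConfig V | ∀ a ∈ A, ¬ (openGraph ω).Reachable o a} ∩ openConn a₁ b := by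
    ext ω
    simp only [hU, mem_sdiff, mem_iUnion, mem_inter_iff, mem_setOf_eq, exists_prop, not_exists, not_and]
    constructor
    · rintro ⟨h1, h2⟩; exact ⟨fun a ha => h2 a ha, h1⟩
    · rintro ⟨h2, h1⟩; exact ⟨h1, fun a ha => h2 a ha⟩
  have hsum := sum_real_clusterIs_inter w A o (openConn a₁ b : Set (BondConfig V))
  rw [← hdiff] at hsum
  have hcutA : ∀ e, e ∉ sideB VB (↑A : Set V) → e ∉ sideT VB (↑A : Set V) → w e = 0 := by
    rw [hAeq]; exact hcut
  have hterm : ∀ W ∈ nullSets A, μ.real (clusterIs o W ∩ openConn a₁ b) =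
      μ.real (clusterIs o W) * A.inf' hA (fun a => μ.real (openConnIn ((↑W : Set V)ᶜ) a b)) := by
    intro W hWn
    have hWA : Disjoint W A := mem_nullSets.1 hWn
    have ha1W : a₁ ∉ W := fun h => Finset.disjoint_left.1 hWA h ha1A
    rw [real_clusterIs_inter_openConn w o W ha1W b]
    by_cases hWVB : (↑W : Set V) ⊆ VB
    · congr 1
      exact le_antisymm ((Finset.le_inf'_iff hA _).2 (hcminW W hWVB)) (Finset.inf'_le _ ha1A)
    · rw [real_clusterIs_eq_zero_of_not_subset w VB A o hcutA ho W hWA hWVB, zero_mul, zero_mul]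
  have hD : ∑ W ∈ nullSets A, μ.real (clusterIs o W) * A.inf' hA (fun a => μ.real (openConnIn ((↑W : Set V)ᶜ) a b)) =
      μ.real (openConn a₁ b \ U) := by
    rw [← hsum]
    exact (Finset.sum_congr rfl hterm).symm
  have hinf : A.inf' hA (fun a => μ.real (openConn a b)) ≤ μ.real (openConn a₁ b) := Finset.inf'_le _ ha1A
  rw [KNGood, hD]
  linarith

/-- **EVERY QUADRUPLE WITH TWO RELAYS IS GOOD.**  Let `VB` be a set of vertices containing the observer `0` and missing
`a₁ ≠ a₂` and `b`, such that no pair joining `VB` to the outside of `VB ∪ {a₁, a₂}` has positive weight (removing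
`A = {a₁, a₂}` separates `0` from `b`).  Then `(G, {a₁, a₂}, 0, b)` is good in the sense of Kozma–Nitzan §3.2:
`P(0 ↔ b) ≥ min_a P(a ↔ b) − Σ_{W ∩ A = ∅} P(C(0) = W) · min_a P_{G∖W}(a ↔ b)` — for an ARBITRARY observer side.
(Kozma–Nitzan prove goodness for one-layer observers, Thm. 4, and chains, Thm. 5; for `|A| = 2` it holds universally:
the pocket-wise minimiser is constant by the two-point amalgamation, and the statement is Question 7 at that minimiser.)
[cite: KozmaNitzan2024, §3.2 Definition and Thms. 4–5 (pp. 12–14), Question 7 (p. 36)] -/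
theorem knGood_two_relays [DecidableEq V] (w : Sym2 V → unitInterval) (VB : Set V) (o b a₁ a₂ : V) (h12 : a₁ ≠ a₂)
    (ho : o ∈ VB) (ha₁ : a₁ ∉ VB) (ha₂ : a₂ ∉ VB) (hb : b ∉ VB)
    (hcut : ∀ e, e ∉ sideB VB ({a₁, a₂} : Set V) → e ∉ sideT VB ({a₁, a₂} : Set V) → w e = 0) :
    KNGood w ({a₁, a₂} : Finset V) (Finset.insert_nonempty a₁ {a₂}) o b := by
  rcases le_total ((prodBernoulli w).real {ω : BondConfig V | rT VB ({a₁, a₂} : Set V) ∅ ω a₁ b})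
      ((prodBernoulli w).real {ω : BondConfig V | rT VB ({a₁, a₂} : Set V) ∅ ω a₂ b}) with h | h
  · exact knGood_two_relays_of_le w VB {a₁, a₂} _ o b a₁ a₂ Finset.coe_pair h12 ho ha₁ ha₂ hb hcut h
  · have hpair : ({a₂, a₁} : Set V) = {a₁, a₂} := Set.pair_comm a₂ a₁
    have hcut' : ∀ e, e ∉ sideB VB ({a₂, a₁} : Set V) → e ∉ sideT VB ({a₂, a₁} : Set V) → w e = 0 := by
      rw [hpair]; exact hcut
    have h' : (prodBernoulli w).real {ω : BondConfig V | rT VB ({a₂, a₁} : Set V) ∅ ω a₂ b} ≤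
        (prodBernoulli w).real {ω : BondConfig V | rT VB ({a₂, a₁} : Set V) ∅ ω a₁ b} := by
      rw [hpair]; exact h
    have hAeq : (↑({a₁, a₂} : Finset V) : Set V) = {a₂, a₁} := by rw [Finset.coe_pair, Set.pair_comm]
    exact knGood_two_relays_of_le w VB {a₁, a₂} _ o b a₂ a₁ hAeq h12.symm ho ha₂ ha₁ hb hcut' h'

end KNGoodTwoRelays

end Summit.CriticalPhenomena.PercolationContinuityZ3.Theorems

end
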